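import Summits.AtomisticToContinuum.HydrodynamicLimit.Theorems.AntiMazurCoboundariesKineticWindowGronwallWindowSubadditivity
import Summits.AtomisticToContinuum.HydrodynamicLimit.Theorems.AntiMazurCoboundariesKineticWindowGronwallQuadraticMoment
import Summits.AtomisticToContinuum.HydrodynamicLimit.Theorems.BoltzmannGreenKubo.Negative.JointMeasurability
import Summits.AtomisticToContinuum.HydrodynamicLimit.Theorems.JParityClosureOddContactSymmetryGibbsInvariance
import Literature.MathematicalPhysics.KineticTheory.HardSphereWindowPressureStatic
import HarnessLib

/-!
# Window upgrade, static bounds and the Cauchy–Schwarz split for kinetic-window exponential moments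

Crux `Summit.AtomisticToContinuum.HydrodynamicLimit.Theses.AntiMazurCoboundaries.KineticWindowGronwall`
(stmt-AtomisticToContinuum-9282, `= KineticFluxLdDecay → RelEntropyVanishing`), skeleton line `rare-band-ladder-dock`
(v2), helper file 1 of 2 toward the registered stub `stub_ladderAssembly : LadderAssembly`
(`ReorthogonalisingCut → KineticFluxLdDecay → RareBandLdDecay → QuadraticClassLdDecay`).

Setting: the homogeneous (constant-profile) local Gibbs law `G_N = localGibbsLaw σ a u θ N Φ` of `N + 1` hard spheres
on `𝕋³` (`σ ≤ 1/2`, `a, θ > 0`, so that `G_N` is a probability measure), ANY hard-sphere flow `Φ` of the right type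
(`G_N` is `Φ`-invariant, `Theorems.measurePreserving_flow_localGibbsLaw_const`, and carried by the good set), a
continuous observable `F` on phase space and the window exponential moments
`Λ(h) := ∫⁻ exp(h⁻¹ ∫₀ʰ F(Φ_s z) ds) dG_N`.

* `aemeasurable_window` — window functionals of a measurable observable are `P`-a.e. measurable whenever
  `P(goodᶜ) = 0` (jointly measurable modification `BoltzmannGreenKuboOrthMomentum.flowMod` of the flow; for the local
  Gibbs law `P(goodᶜ) = 0` is `KineticWindowGronwallQuadraticMoment.ae_mem_good_localGibbsLaw`).
* `window_upgrade` — **THE WINDOW UPGRADE `∃ h₁ ⇒ ∀ h ≥ h₁`**: if `Λ(h₁) ≤ e^{δ(N+1)}` and the STATIC moment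
  `∫⁻ exp F dG_N ≤ e^{C(N+1)}` (`δ, C ≥ 0`), then `Λ(h) ≤ e^{(δ + C h₁/h)(N+1)}` for every `h ≥ h₁`: write
  `h = m h₁ + r`, `m = ⌊h/h₁⌋ ≥ 1`, `0 ≤ r < h₁`; `Λ(m h₁) ≤ Λ(h₁)` (landed window subadditivity
  `KineticWindowGronwallWindowSubadditivity.lintegral_exp_window_mul_le_of_aemeasurable`); two-window Hölder
  `Λ(m h₁ + r) ≤ Λ(m h₁)^{m h₁/h} Λ(r)^{r/h}` (landed `lintegral_exp_window_add_le_of_aemeasurable`); and Jensen in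
  time + invariance `Λ(r) ≤ ∫⁻ exp F` (Literature `HardSphereFlow.lintegral_exp_windowAvg_le_of_invariant`).
* `lintegral_exp_le_of_le` / `lintegral_exp_oneBody_quarter_le` — the two static bounds used by the ladder: a bounded
  exponent, and the Gaussian one-site factorisation for a one-body profile dominated by `‖w‖²/4` in the scaled
  peculiar velocity `w = (v − u)/√θ` (`Literature.lintegral_exp_sum_localGibbsMeasure_const_le` with the one-site
  value `∫⁻ e^{‖w‖²/4} dγ = 2^{3/2} ≤ e²`).
* `window_split_le_geomMean` — **CAUCHY–SCHWARZ SPLIT**: if `F = ½F₁ + ½F₂` with `F₁, F₂` continuous, then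
  `Λ_F(h) ≤ Λ_{F₁}(h)^{1/2} Λ_{F₂}(h)^{1/2}` (linearity of the window functional on good orbits, Hölder
  `ENNReal.lintegral_mul_norm_pow_le`).

References: S. Olla, S. R. S. Varadhan, H.-T. Yau, Comm. Math. Phys. 155 (1993) §2–3 (window log-moment generating
functions under a stationary law); C. Kipnis, C. Landim, *Scaling Limits of Interacting Particle Systems* (1999),
App. 1 §5–6.
-/

noncomputable section

open MeasureTheory Set Filter
open scoped ENNReal
open Literature.Analysis.FluidPDE Literature.MathematicalPhysics.KineticTheory

namespace Summit.AtomisticToContinuum.HydrodynamicLimit.Theorems.KineticWindowGronwallLadder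

variable {σ : ℝ} {N : ℕ}

/-! ## §1 Measurability of window functionals -/

/-- **Window functionals of a measurable observable are a.e. measurable** under any law carried by the good set:
`z ↦ ∫ₐᵇ F(Φ_s z) ds` is `P`-a.e. measurable when `P(goodᶜ) = 0` (the flow modified off the good set,
`BoltzmannGreenKuboOrthMomentum.flowMod`, is jointly measurable and agrees with the flow along good orbits).
[folklore] -/
theorem aemeasurable_window (Φ : HardSphereFlow (Torus.geometry (Fin 3)) (hsDiameter σ N) (N + 1))
    {P : Measure (Config (N + 1) (Fin 3) T3)} (hP : P Φ.goodᶜ = 0)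
    {F : Config (N + 1) (Fin 3) T3 → ℝ} (hF : Measurable F) (a b : ℝ) :
    AEMeasurable (fun z => ∫ s in a..b, F (Φ.flow s z)) P :=
  KineticWindowGronwallWindowSubadditivity.aemeasurable_window_of_modification Φ P hP F
    (g := fun s z => F (BoltzmannGreenKuboOrthMomentum.flowMod Φ (s, z)))
    (hF.comp (BoltzmannGreenKuboOrthMomentum.measurable_flowMod Φ))
    (fun z hz s => by simp only [BoltzmannGreenKuboOrthMomentum.flowMod_of_mem Φ hz]) a b

/-! ## §2 The window upgrade `∃ h₁ ⇒ ∀ h ≥ h₁` -/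

/-- **THE WINDOW UPGRADE.** For the homogeneous local Gibbs law `G_N = localGibbsLaw σ a u θ N Φ` (`σ ≤ 1/2`,
`a, θ > 0`), any flow `Φ`, a continuous observable `F`, a window `h₁ > 0` with
`∫⁻ exp(h₁⁻¹∫₀^{h₁} F(Φ_s z) ds) dG_N ≤ e^{δ(N+1)}` and the static bound `∫⁻ exp F dG_N ≤ e^{C(N+1)}` (`δ, C ≥ 0`): for
every `h ≥ h₁`, `∫⁻ exp(h⁻¹∫₀ʰ F(Φ_s z) ds) dG_N ≤ e^{(δ + C h₁/h)(N+1)}`. [cite: OllaVaradhanYau1993, §2] -/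
theorem window_upgrade {σ a θ : ℝ} (hσ2 : σ ≤ 1 / 2) (ha : 0 < a) (hθ : 0 < θ) (u : V3) (N : ℕ)
    (Φ : HardSphereFlow (Torus.geometry (Fin 3)) (hsDiameter σ N) (N + 1))
    {F : Config (N + 1) (Fin 3) T3 → ℝ} (hF : Continuous F) {h₁ δ C : ℝ} (h₁0 : 0 < h₁) (hδ : 0 ≤ δ)
    (hC : 0 ≤ C)
    (hwin : ∫⁻ z, ENNReal.ofReal (Real.exp (h₁⁻¹ * ∫ s in (0 : ℝ)..h₁, F (Φ.flow s z)))
        ∂(localGibbsLaw σ (fun _ => a) (fun _ => u) (fun _ => θ) N Φ) ≤ ENNReal.ofReal (Real.exp (δ * (N + 1))))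
    (hstat : ∫⁻ z, ENNReal.ofReal (Real.exp (F z)) ∂(localGibbsLaw σ (fun _ => a) (fun _ => u) (fun _ => θ) N Φ) ≤
        ENNReal.ofReal (Real.exp (C * (N + 1))))
    {h : ℝ} (hh : h₁ ≤ h) :
    ∫⁻ z, ENNReal.ofReal (Real.exp (h⁻¹ * ∫ s in (0 : ℝ)..h, F (Φ.flow s z)))
        ∂(localGibbsLaw σ (fun _ => a) (fun _ => u) (fun _ => θ) N Φ) ≤
      ENNReal.ofReal (Real.exp ((δ + C * (h₁ / h)) * (N + 1))) := by
  set P := localGibbsLaw σ (fun _ => a) (fun _ => u) (fun _ => θ) N Φ with hP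
  haveI : IsProbabilityMeasure P := isProbabilityMeasure_localGibbsLaw continuous_const continuous_const
    continuous_const (fun _ => ha) (fun _ => hθ) hσ2 N Φ
  have hgood : P Φ.goodᶜ = 0 :=
    mem_ae_iff.1 (KineticWindowGronwallQuadraticMoment.ae_mem_good_localGibbsLaw σ (fun _ => a) (fun _ => u)
      (fun _ => θ) N Φ)
  have hinv : ∀ t : ℝ, MeasurePreserving (Φ.flow t) P P := fun t =>
    measurePreserving_flow_localGibbsLaw_const σ a θ u N Φ t
  have hint : ∀ z ∈ Φ.good, ∀ a' b' : ℝ, IntervalIntegrable (fun s => F (Φ.flow s z)) volume a' b' :=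
    fun z hz a' b' => Φ.intervalIntegrable_comp_flow_of_continuous hz hF a' b'
  have hY : ∀ c : ℝ, AEMeasurable (fun z => ∫ s in (0 : ℝ)..c, F (Φ.flow s z)) P := fun c =>
    aemeasurable_window Φ hgood hF.measurable 0 c
  have hh0 : 0 < h := h₁0.trans_le hh
  have hN : (0 : ℝ) < (N : ℝ) + 1 := by positivity
  -- the integer part of `h / h₁`
  set m : ℕ := ⌊h / h₁⌋₊ with hm
  have hx1 : 1 ≤ h / h₁ := by rwa [le_div_iff₀ h₁0, one_mul]
  have hmpos : 0 < m := Nat.floor_pos.2 hx1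
  have hmle : (m : ℝ) * h₁ ≤ h := by
    have h1 : (m : ℝ) ≤ h / h₁ := Nat.floor_le (div_nonneg hh0.le h₁0.le)
    rwa [le_div_iff₀ h₁0] at h1
  have hlt : h < ((m : ℝ) + 1) * h₁ := by
    have h1 : h / h₁ < (m : ℝ) + 1 := Nat.lt_floor_add_one (h / h₁)
    rwa [div_lt_iff₀ h₁0] at h1
  set r : ℝ := h - (m : ℝ) * h₁ with hr
  have hr0 : 0 ≤ r := by rw [hr]; linarith
  have hrlt : r < h₁ := by rw [hr]; linarith
  have hsplit : h = (m : ℝ) * h₁ + r := by rw [hr]; ring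
  -- the block bound `Λ(m h₁) ≤ Λ(h₁) ≤ e^{δ(N+1)}`
  have hblock : ∫⁻ z, ENNReal.ofReal (Real.exp (((m : ℝ) * h₁)⁻¹ *
      ∫ s in (0 : ℝ)..((m : ℝ) * h₁), F (Φ.flow s z))) ∂P ≤ ENNReal.ofReal (Real.exp (δ * (N + 1))) :=
    (KineticWindowGronwallWindowSubadditivity.lintegral_exp_window_mul_le_of_aemeasurable Φ P hgood h₁ (hinv h₁)
      F hint (hY h₁) m hmpos).trans hwin
  have hexp_mono : Real.exp (δ * (N + 1)) ≤ Real.exp ((δ + C * (h₁ / h)) * (N + 1)) := by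
    refine Real.exp_le_exp.2 (mul_le_mul_of_nonneg_right ?_ hN.le)
    have : 0 ≤ C * (h₁ / h) := mul_nonneg hC (div_nonneg h₁0.le hh0.le)
    linarith
  rcases hr0.eq_or_lt with hr00 | hrpos
  · -- `h = m h₁`: subadditivity alone
    have hh' : h = (m : ℝ) * h₁ := by linarith
    have hL : ∫⁻ z, ENNReal.ofReal (Real.exp (h⁻¹ * ∫ s in (0 : ℝ)..h, F (Φ.flow s z))) ∂P =
        ∫⁻ z, ENNReal.ofReal (Real.exp (((m : ℝ) * h₁)⁻¹ * ∫ s in (0 : ℝ)..((m : ℝ) * h₁), F (Φ.flow s z))) ∂P := by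
      rw [hh']
    rw [hL]
    exact hblock.trans (ENNReal.ofReal_le_ofReal hexp_mono)
  · -- `0 < r < h₁`: two-window Hölder, the remainder paid statically
    have hmh : 0 < (m : ℝ) * h₁ := by positivity
    have key := KineticWindowGronwallWindowSubadditivity.lintegral_exp_window_add_le_of_aemeasurable Φ P hgood hmh
      hrpos (hinv _) F hint (hY _) (hY _) 1
    simp only [one_mul] at key
    have hrem : ∫⁻ z, ENNReal.ofReal (Real.exp (r⁻¹ * ∫ s in (0 : ℝ)..r, F (Φ.flow s z))) ∂P ≤
        ENNReal.ofReal (Real.exp (C * (N + 1))) :=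
      (Φ.lintegral_exp_windowAvg_le_of_invariant P hgood hinv hF.measurable hrpos
        (fun z hz => hint z hz 0 r)).trans hstat
    set p : ℝ := (m : ℝ) * h₁ / ((m : ℝ) * h₁ + r) with hp
    set q : ℝ := r / ((m : ℝ) * h₁ + r) with hq
    have hhr : 0 < (m : ℝ) * h₁ + r := by positivity
    have hp0 : 0 ≤ p := div_nonneg hmh.le hhr.le
    have hq0 : 0 ≤ q := div_nonneg hrpos.le hhr.le
    have hp1 : p ≤ 1 := by
      rw [hp, div_le_one hhr]
      linarith
    have hq1 : q ≤ h₁ / h := by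
      rw [hq, ← hsplit]
      exact div_le_div_of_nonneg_right hrlt.le hh0.le
    have main : ∫⁻ z, ENNReal.ofReal (Real.exp ((((m : ℝ) * h₁ + r))⁻¹ *
        ∫ s in (0 : ℝ)..((m : ℝ) * h₁ + r), F (Φ.flow s z))) ∂P ≤
        ENNReal.ofReal (Real.exp ((δ + C * (h₁ / h)) * (N + 1))) := by
      calc _ ≤ (∫⁻ z, ENNReal.ofReal (Real.exp (((m : ℝ) * h₁)⁻¹ *
              ∫ s in (0 : ℝ)..((m : ℝ) * h₁), F (Φ.flow s z))) ∂P) ^ p *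
            (∫⁻ z, ENNReal.ofReal (Real.exp (r⁻¹ * ∫ s in (0 : ℝ)..r, F (Φ.flow s z))) ∂P) ^ q := key
        _ ≤ ENNReal.ofReal (Real.exp (δ * (N + 1))) ^ p * ENNReal.ofReal (Real.exp (C * (N + 1))) ^ q :=
            mul_le_mul' (ENNReal.rpow_le_rpow hblock hp0) (ENNReal.rpow_le_rpow hrem hq0)
        _ = ENNReal.ofReal (Real.exp (p * (δ * (N + 1)) + q * (C * (N + 1)))) := by
            rw [Real.exp_add, ENNReal.ofReal_mul (Real.exp_pos _).le, KineticWindowGronwallWindowSubadditivity.ofReal_exp_mul_left p _ hp0,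
              KineticWindowGronwallWindowSubadditivity.ofReal_exp_mul_left q _ hq0]
        _ ≤ ENNReal.ofReal (Real.exp ((δ + C * (h₁ / h)) * (N + 1))) := by
            refine ENNReal.ofReal_le_ofReal (Real.exp_le_exp.2 ?_)
            have h1 : p * (δ * (N + 1)) ≤ δ * (N + 1) := by
              have : 0 ≤ δ * (N + 1) := mul_nonneg hδ hN.le
              nlinarith
            have h2 : q * (C * (N + 1)) ≤ (h₁ / h) * (C * (N + 1)) :=
              mul_le_mul_of_nonneg_right hq1 (mul_nonneg hC hN.le)
            nlinarith
    have hL : ∫⁻ z, ENNReal.ofReal (Real.exp (h⁻¹ * ∫ s in (0 : ℝ)..h, F (Φ.flow s z))) ∂P =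
        ∫⁻ z, ENNReal.ofReal (Real.exp ((((m : ℝ) * h₁ + r))⁻¹ *
          ∫ s in (0 : ℝ)..((m : ℝ) * h₁ + r), F (Φ.flow s z))) ∂P := by
      rw [← hsplit]
    rw [hL]
    exact main

/-! ## §3 Static bounds -/

/-- A bounded exponent has exponential moment at most `e^{B}` under a probability measure. [folklore] -/
theorem lintegral_exp_le_of_le {α : Type*} [MeasurableSpace α] (P : Measure α) [IsProbabilityMeasure P]
    {F : α → ℝ} {B : ℝ} (hB : ∀ z, F z ≤ B) :
    ∫⁻ z, ENNReal.ofReal (Real.exp (F z)) ∂P ≤ ENNReal.ofReal (Real.exp B) := by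
  calc ∫⁻ z, ENNReal.ofReal (Real.exp (F z)) ∂P ≤ ∫⁻ _z, ENNReal.ofReal (Real.exp B) ∂P :=
        lintegral_mono fun z => ENNReal.ofReal_le_ofReal (Real.exp_le_exp.2 (hB z))
    _ = ENNReal.ofReal (Real.exp B) := by rw [lintegral_const, measure_univ, mul_one]

/-- `gaussMeasure 0 1` is the standard Gaussian. [folklore] -/
theorem gaussMeasure_zero_one : gaussMeasure (0 : V3) 1 = ProbabilityTheory.stdGaussian V3 := by
  rw [gaussMeasure]
  simp only [Real.sqrt_one, one_smul, zero_add]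
  exact Measure.map_id

/-- **The one-site Gaussian value**: `∫⁻ e^{‖w‖²/4} dγ(w) = 2^{3/2} ≤ e²` for the standard Gaussian `γ` on `ℝ³`.
[folklore] -/
theorem lintegral_exp_quarter_sq_norm_stdGaussian_le :
    ∫⁻ w, ENNReal.ofReal (Real.exp ((1 / 4 : ℝ) * ‖w‖ ^ 2)) ∂(ProbabilityTheory.stdGaussian V3) ≤
      ENNReal.ofReal (Real.exp 2) := by
  have h := KineticWindowGronwallQuadraticMoment.lintegral_exp_mul_sq_norm_gaussMeasure (θ := 1) (lam := 1 / 4)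
    one_pos (by norm_num)
  rw [gaussMeasure_zero_one] at h
  rw [h]
  refine ENNReal.ofReal_le_ofReal ?_
  have h1 : (1 - 2 * (1 / 4 : ℝ) * 1) ^ (-(3 / 2 : ℝ)) = 2 ^ (3 / 2 : ℝ) := by
    rw [show (1 - 2 * (1 / 4 : ℝ) * 1) = (2 : ℝ)⁻¹ by norm_num, Real.inv_rpow (by norm_num : (0 : ℝ) ≤ 2),
      Real.rpow_neg (by norm_num : (0 : ℝ) ≤ 2), inv_inv]
  have h2 : (2 : ℝ) ^ (3 / 2 : ℝ) ≤ 2 ^ (2 : ℝ) :=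
    Real.rpow_le_rpow_of_exponent_le (by norm_num) (by norm_num)
  have h3 : (2 : ℝ) ^ (2 : ℝ) = 4 := by
    rw [Real.rpow_two]; norm_num
  have h4 : (4 : ℝ) ≤ Real.exp 2 := by
    have he : (2 : ℝ) < Real.exp 1 := by
      have := Real.exp_one_gt_d9
      linarith
    have hadd : Real.exp 2 = Real.exp 1 * Real.exp 1 := by
      rw [← Real.exp_add]; norm_num
    rw [hadd]
    nlinarith [Real.exp_pos 1]
  rw [h1]
  linarith

/-- **Static Gaussian bound for a one-body profile dominated by `‖w‖²/4`**: under the homogeneous local Gibbs law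
(`σ ≤ 1/2`, `a, θ > 0`), for continuous `φ, G` with `|φ| ≤ 1` and `|G w| ≤ ‖w‖²/4`,
`∫⁻ exp(Σᵢ φ(xᵢ) G((vᵢ − u)/√θ)) dG_N ≤ e^{2(N+1)}` (one-site factorisation
`lintegral_exp_sum_localGibbsMeasure_const_le`; the scaled peculiar velocity is standard Gaussian). [folklore] -/
theorem lintegral_exp_oneBody_quarter_le {σ a θ : ℝ} (hσ2 : σ ≤ 1 / 2) (ha : 0 < a) (hθ : 0 < θ) (u : V3) (N : ℕ)
    (Φ : HardSphereFlow (Torus.geometry (Fin 3)) (hsDiameter σ N) (N + 1))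
    {φ : T3 → ℝ} {G : V3 → ℝ} (hφc : Continuous φ) (hGc : Continuous G) (hφ : ∀ x, |φ x| ≤ 1)
    (hG : ∀ w, |G w| ≤ (1 / 4 : ℝ) * ‖w‖ ^ 2) :
    ∫⁻ z, ENNReal.ofReal (Real.exp (∑ i, φ (z i).1 * G ((Real.sqrt θ)⁻¹ • ((z i).2 - u))))
        ∂(localGibbsLaw σ (fun _ => a) (fun _ => u) (fun _ => θ) N Φ) ≤
      ENNReal.ofReal (Real.exp (2 * (N + 1))) := by
  set q : T3 × V3 → ℝ := fun p => φ p.1 * G ((Real.sqrt θ)⁻¹ • (p.2 - u)) with hq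
  have hqc : Continuous q := by
    have hsm : Continuous fun p : T3 × V3 => (Real.sqrt θ)⁻¹ • (p.2 - u) := by fun_prop
    exact (hφc.comp continuous_fst).mul (hGc.comp hsm)
  have hone : ∀ x : T3, ∫⁻ v, ENNReal.ofReal (Real.exp (q (x, v))) ∂(gaussMeasure u θ) ≤
      ENNReal.ofReal (Real.exp 2) := by
    intro x
    have hpt : ∀ v : V3, ENNReal.ofReal (Real.exp (q (x, v))) ≤
        ENNReal.ofReal (Real.exp ((1 / 4 : ℝ) * ‖(Real.sqrt θ)⁻¹ • (v - u)‖ ^ 2)) := fun v => by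
      refine ENNReal.ofReal_le_ofReal (Real.exp_le_exp.2 ?_)
      have h1 : |q (x, v)| ≤ (1 / 4 : ℝ) * ‖(Real.sqrt θ)⁻¹ • (v - u)‖ ^ 2 := by
        simp only [hq, abs_mul]
        calc |φ x| * |G ((Real.sqrt θ)⁻¹ • (v - u))| ≤ 1 * ((1 / 4 : ℝ) * ‖(Real.sqrt θ)⁻¹ • (v - u)‖ ^ 2) :=
              mul_le_mul (hφ x) (hG _) (abs_nonneg _) zero_le_one
          _ = _ := one_mul _
      exact (le_abs_self _).trans h1
    calc ∫⁻ v, ENNReal.ofReal (Real.exp (q (x, v))) ∂(gaussMeasure u θ)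
        ≤ ∫⁻ v, ENNReal.ofReal (Real.exp ((1 / 4 : ℝ) * ‖(Real.sqrt θ)⁻¹ • (v - u)‖ ^ 2)) ∂(gaussMeasure u θ) :=
          lintegral_mono hpt
      _ = ∫⁻ w, ENNReal.ofReal (Real.exp ((1 / 4 : ℝ) * ‖w‖ ^ 2)) ∂(ProbabilityTheory.stdGaussian V3) :=
          lintegral_gaussMeasure_eq_lintegral_stdGaussian_sv hθ u
            (f := fun w => ENNReal.ofReal (Real.exp ((1 / 4 : ℝ) * ‖w‖ ^ 2)))
            (KineticWindowGronwallQuadraticMoment.measurable_ofReal_exp_mul_sq_norm (1 / 4 : ℝ))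
      _ ≤ ENNReal.ofReal (Real.exp 2) := lintegral_exp_quarter_sq_norm_stdGaussian_le
  have hmain := lintegral_exp_sum_localGibbsMeasure_const_le ha hθ u hσ2 N hqc.measurable hone
  rw [localGibbsLaw_eq]
  refine hmain.trans_eq ?_
  rw [← ENNReal.ofReal_pow (Real.exp_pos _).le, ← Real.exp_nat_mul]
  congr 2
  push_cast
  ring

/-! ## §4 The Cauchy–Schwarz split of a window moment -/

/-- **CAUCHY–SCHWARZ SPLIT.** For a law `P` carried by the good set of `Φ`, continuous `F₁, F₂` and `F` with
`F = ½F₁ + ½F₂` pointwise, and any window `h`: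
`∫⁻ exp(h⁻¹∫₀ʰ F(Φ_s z)) dP ≤ (∫⁻ exp(h⁻¹∫₀ʰ F₁(Φ_s z)) dP)^{1/2} (∫⁻ exp(h⁻¹∫₀ʰ F₂(Φ_s z)) dP)^{1/2}`
(linearity of the time integral along good orbits — continuous observables are interval integrable there — and
Hölder with exponents `½ + ½ = 1`). [folklore] -/
theorem window_split_le_geomMean (Φ : HardSphereFlow (Torus.geometry (Fin 3)) (hsDiameter σ N) (N + 1))
    {P : Measure (Config (N + 1) (Fin 3) T3)} (hP : P Φ.goodᶜ = 0)
    {F F₁ F₂ : Config (N + 1) (Fin 3) T3 → ℝ} (hF₁ : Continuous F₁) (hF₂ : Continuous F₂)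
    (hsum : ∀ z, F z = (1 / 2 : ℝ) * F₁ z + (1 / 2 : ℝ) * F₂ z) (h : ℝ) :
    ∫⁻ z, ENNReal.ofReal (Real.exp (h⁻¹ * ∫ s in (0 : ℝ)..h, F (Φ.flow s z))) ∂P ≤
      (∫⁻ z, ENNReal.ofReal (Real.exp (h⁻¹ * ∫ s in (0 : ℝ)..h, F₁ (Φ.flow s z))) ∂P) ^ (1 / 2 : ℝ) *
      (∫⁻ z, ENNReal.ofReal (Real.exp (h⁻¹ * ∫ s in (0 : ℝ)..h, F₂ (Φ.flow s z))) ∂P) ^ (1 / 2 : ℝ) := by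
  have hae : ∀ᵐ z ∂P, z ∈ Φ.good := mem_ae_iff.mpr hP
  have hY : ∀ {F' : Config (N + 1) (Fin 3) T3 → ℝ}, Continuous F' →
      AEMeasurable (fun z => ENNReal.ofReal (Real.exp (h⁻¹ * ∫ s in (0 : ℝ)..h, F' (Φ.flow s z)))) P :=
    fun hF' => ENNReal.measurable_ofReal.comp_aemeasurable
      (Real.measurable_exp.comp_aemeasurable ((aemeasurable_window Φ hP hF'.measurable 0 h).const_mul _))
  have hpt : ∀ z ∈ Φ.good, ENNReal.ofReal (Real.exp (h⁻¹ * ∫ s in (0 : ℝ)..h, F (Φ.flow s z))) =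
      ENNReal.ofReal (Real.exp (h⁻¹ * ∫ s in (0 : ℝ)..h, F₁ (Φ.flow s z))) ^ (1 / 2 : ℝ) *
      ENNReal.ofReal (Real.exp (h⁻¹ * ∫ s in (0 : ℝ)..h, F₂ (Φ.flow s z))) ^ (1 / 2 : ℝ) := by
    intro z hz
    have h1 : IntervalIntegrable (fun s => F₁ (Φ.flow s z)) volume 0 h :=
      Φ.intervalIntegrable_comp_flow_of_continuous hz hF₁ 0 h
    have h2 : IntervalIntegrable (fun s => F₂ (Φ.flow s z)) volume 0 h :=
      Φ.intervalIntegrable_comp_flow_of_continuous hz hF₂ 0 h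
    have hI : ∫ s in (0 : ℝ)..h, F (Φ.flow s z) =
        (1 / 2 : ℝ) * (∫ s in (0 : ℝ)..h, F₁ (Φ.flow s z)) + (1 / 2 : ℝ) * ∫ s in (0 : ℝ)..h, F₂ (Φ.flow s z) := by
      rw [← intervalIntegral.integral_const_mul, ← intervalIntegral.integral_const_mul,
        ← intervalIntegral.integral_add (h1.const_mul _) (h2.const_mul _)]
      exact intervalIntegral.integral_congr fun s _ => hsum _
    rw [hI, mul_add, ← mul_assoc, ← mul_assoc, mul_comm h⁻¹ (1 / 2 : ℝ), mul_assoc, mul_assoc, Real.exp_add,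
      ENNReal.ofReal_mul (Real.exp_pos _).le, KineticWindowGronwallWindowSubadditivity.ofReal_exp_mul_left (1 / 2 : ℝ) _ (by norm_num),
      KineticWindowGronwallWindowSubadditivity.ofReal_exp_mul_left (1 / 2 : ℝ) _ (by norm_num)]
  calc ∫⁻ z, ENNReal.ofReal (Real.exp (h⁻¹ * ∫ s in (0 : ℝ)..h, F (Φ.flow s z))) ∂P
      = ∫⁻ z, ENNReal.ofReal (Real.exp (h⁻¹ * ∫ s in (0 : ℝ)..h, F₁ (Φ.flow s z))) ^ (1 / 2 : ℝ) *
          ENNReal.ofReal (Real.exp (h⁻¹ * ∫ s in (0 : ℝ)..h, F₂ (Φ.flow s z))) ^ (1 / 2 : ℝ) ∂P :=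
        lintegral_congr_ae (hae.mono hpt)
    _ ≤ _ := ENNReal.lintegral_mul_norm_pow_le (hY hF₁) (hY hF₂) (by norm_num) (by norm_num) (by norm_num)

/-! ## §5 The registered helper statement of this file -/

/-- **WINDOW UPGRADE UNDER THE INVARIANT HOMOGENEOUS GIBBS LAW (registered helper stub `stub_ladderWindowUpgrade`).**
For `σ ≤ 1/2`, `a, θ > 0`, any drift `u`, any flow `Φ` of `N + 1` spheres, a continuous observable `F`, a window
`h₁ > 0` with `∫⁻ exp(h₁⁻¹∫₀^{h₁} F(Φ_s z) ds) dG_N ≤ e^{δ(N+1)}` and the static bound `∫⁻ exp F dG_N ≤ e^{C(N+1)}`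
(`δ, C ≥ 0`): for every `h ≥ h₁`, `∫⁻ exp(h⁻¹∫₀ʰ F(Φ_s z) ds) dG_N ≤ e^{(δ + C h₁/h)(N+1)}`. -/
def LadderWindowUpgrade : Prop :=
  ∀ (σ a θ : ℝ) (u : V3) (N : ℕ) (Φ : HardSphereFlow (Torus.geometry (Fin 3)) (hsDiameter σ N) (N + 1))
    (F : Config (N + 1) (Fin 3) T3 → ℝ) (h₁ δ C h : ℝ), σ ≤ 1 / 2 → 0 < a → 0 < θ → Continuous F →
    0 < h₁ → 0 ≤ δ → 0 ≤ C →
    ∫⁻ z, ENNReal.ofReal (Real.exp (h₁⁻¹ * ∫ s in (0 : ℝ)..h₁, F (Φ.flow s z)))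
        ∂(localGibbsLaw σ (fun _ => a) (fun _ => u) (fun _ => θ) N Φ) ≤ ENNReal.ofReal (Real.exp (δ * (N + 1))) →
    ∫⁻ z, ENNReal.ofReal (Real.exp (F z)) ∂(localGibbsLaw σ (fun _ => a) (fun _ => u) (fun _ => θ) N Φ) ≤
        ENNReal.ofReal (Real.exp (C * (N + 1))) →
    h₁ ≤ h →
    ∫⁻ z, ENNReal.ofReal (Real.exp (h⁻¹ * ∫ s in (0 : ℝ)..h, F (Φ.flow s z)))
        ∂(localGibbsLaw σ (fun _ => a) (fun _ => u) (fun _ => θ) N Φ) ≤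
      ENNReal.ofReal (Real.exp ((δ + C * (h₁ / h)) * (N + 1)))

/-- **Proved**: `stub_ladderWindowUpgrade` (`window_upgrade`). [cite: OllaVaradhanYau1993, §2] -/
theorem stub_ladderWindowUpgrade : LadderWindowUpgrade :=
  fun _ _ _ u N Φ _ _ _ _ _ hσ2 ha hθ hF h₁0 hδ hC hwin hstat hh =>
    window_upgrade hσ2 ha hθ u N Φ hF h₁0 hδ hC hwin hstat hh

end Summit.AtomisticToContinuum.HydrodynamicLimit.Theorems.KineticWindowGronwallLadder

end
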